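import Summits.QuantumFields.BalabanUV.T4Continuum.Spine.NE9.TowerCarriersBoxWitness
import Summits.QuantumFields.BalabanUV.T4Continuum.Spine.NE9.AnalyticBranchPropagation

/-!
# T⁴ programme, spine estimate NE9 — THE ANALYTIC BRANCH, END TO END IN ONE STATEMENT: tower-NE5 over the t-box + per-run
# [H-dil]-STEP (last coupling) + holomorphic class-reproducing steps + holomorphy-preserving transports + evaluation ⇒ node U3's bracket
# majorant and node U6's `Summable delta`, with NO constant of the one-step map (assembly of census rows C29 + C29b, seat ne9 gen 5)

Cell `pub-balaban-gaps` (YM blitz G2, seat ne9, unit `pub-balaban-gaps-ne9-g5`; record `run/shared/lean/pub/pub-balaban-gaps/ne/NE9.md` §5 rows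
C29∕C29b).  Pure composition, no new idea: `AnalyticBranchPropagation.ne9_boxWindow_of_propagation` (C29b) run by run IS the `h9` binder
`TowerCarriersBox.TowerNE9On T E [t₀,∞[ κ (4B̄∕(c t₀))` of `TowerCarriersBox.summable_delta_of_towerOn_bounded` (C29); this file writes the
composite once, with every binder displayed, so that the E-side obligation list of node U3 → U6 GIVEN tower-NE5 can be read off ONE kernel
statement (§1), and checks that the composite's binders are JOINTLY, NON-TRIVIALLY INHABITED (§2: the vertex toy of `TowerCarriersBoxWitness` IS an
instance of the propagation data — `F = ℂ`, step `Φ z w = a·w + cos(log z)`, transport = the last activity, classes = the closed disc of radius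
`e^π∕(1−a)` — and `summable_delta_of_propagation` FIRES on it, `summable_delta_propagation_vertexToy`): per run `k`, activities `V k j g` in a complete normed ℂ-space with (P) prefix dependence, (M) membership of real-history activities
in inductive classes `A k m ⊆ {‖·‖ ≤ B̄}`, (R) the recursion through a transport reading the levels `≤ j` and preserving holomorphy,
(O) at real last couplings a step holomorphic in the old data REPRODUCING the classes, (L) [H-dil]-STEP — holomorphy in a complex LAST coupling
on the relative discs `|z − s| ≤ c|s|`, `s ≥ t₀`, values in the next class —, (E) an `e^{−κd}`-Lipschitz evaluation of the scale-`(k − r X)`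
activity; plus tower-NE5 over the t-box and a t-discrepancy profile of finite first moment.  OUTPUT: a cutoff-independent injection dominating
node U3's coupling bracket at every domain of every run, and `Summable (T4CauchySum.delta E₀ ρ inj)`.  NOT in the list: any Lipschitz
constant of the step, (AN-OLD)'s margin∕bound, (CONTR), the memory-rate gap, W4, W5, `FadingMemory`, N2.

HONEST FRAMING: bookkeeping for rung (B)+1 on ONE FIXED finite four-torus; hypothesis SHAPES only; tower-NE5 = the cell's NE5 (NOT PRINTED, NOT
PROVED) at every pair of consecutive run lengths; (L)∕(O)∕(M) for Bałaban's step are NOT PRINTED as theorems (H∃ readings of [Balaban1987RG1]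
p. 266 and Thm 3 p. 264) and NOT PROVED — for his `E^{(j)}` the data `V, Φ, T, A` ARE the one-step object W1 (instance 0∕1); NE9 NOT PRINTED ∕ NOT
PROVED; spine PROVED 0∕9 unchanged; NOT UV stability, NOT the continuum limit, NOT infinite volume, NOT a mass gap, NOT Clay.  HONEST DEPENDENCY:
continuum YM on T⁴ ⇐ BetaPertH ∧ nine spine estimates (0∕9 proved); BetaPertH ⇐ (D1) ∧ (D4) ∧ CAP+tail.
-/

namespace Summit.QuantumFields.BalabanUV.T4Continuum.NE9.AnalyticBranchAssembly

open Metric Set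
open scoped BigOperators
open Finset (Ico)
open Literature.MathematicalPhysics.QuantumFieldTheory.Balaban1983to89
open Literature.MathematicalPhysics.QuantumFieldTheory.Balaban1983to89.T4OutputRate
open Literature.MathematicalPhysics.QuantumFieldTheory.Balaban1983to89.T4CouplingAnalyticity (BoxWindow)
open T4CauchySum (delta)
open Summit.QuantumFields.BalabanUV.T4Continuum.NE9.TowerCarriers (TowerData)
open Summit.QuantumFields.BalabanUV.T4Continuum.NE9.TowerCarriersBox
open Summit.QuantumFields.BalabanUV.T4Continuum.NE9.AnalyticBranchPropagation
open Summit.QuantumFields.BalabanUV.T4Continuum.NE9.TowerRateRelocation (linTower linTower_succ)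
open Summit.QuantumFields.BalabanUV.T4Continuum.NE9.TowerCarriersWitness (toyTower toyE)
open Summit.QuantumFields.BalabanUV.T4Continuum.NE9.TowerCarriersBoxWitness

/-! ## §1 The composite END -/

section Composite

variable {F : Type*} [NormedAddCommGroup F] [NormedSpace ℂ F] [CompleteSpace F]

/-- **PER-RUN PROPAGATION ⇒ TOWER-NE9 OVER THE t-BOX WITH ONE BOUNDED MODULUS.**  For every run `k` of a tower of carriers, activities
`V k`, steps `Φ k`, transports `T k`, inductive classes `A k` with ONE bound `B̄`, and an evaluation `ev k` as in
`AnalyticBranchPropagation.ne9_boxWindow_of_propagation` ⇒ `TowerCarriersBox.TowerNE9On T E [t₀,∞[ κ (4B̄∕(c t₀))`. [folklore] -/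
theorem towerNE9On_of_propagation (T : TowerData) {E : ℕ → (ℕ → ℝ) → T.B → T.Dom → ℝ}
    {V : ℕ → ℕ → (ℕ → ℝ) → F} {Φ : ℕ → ℕ → ℂ → F → F} {Tr : ℕ → ℕ → (ℕ → F) → F} {A : ℕ → ℕ → Set F}
    {ev : (k : ℕ) → F → T.B → T.Dom → ℝ} {t₀ c Bbar κ : ℝ} (ht₀ : 0 < t₀) (hc : 0 < c)
    (hAB : ∀ k m, ∀ a ∈ A k m, ‖a‖ ≤ Bbar)
    (hP : ∀ k m, ∀ g ∈ BoxWindow (Set.Ici t₀), ∀ g' ∈ BoxWindow (Set.Ici t₀), (∀ n < m, g n = g' n) → V k m g = V k m g')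
    (hmem : ∀ k m, ∀ g ∈ BoxWindow (Set.Ici t₀), V k m g ∈ A k m)
    (hrec : ∀ k j, ∀ g ∈ BoxWindow (Set.Ici t₀), V k (j + 1) g = Φ k j (g j : ℂ) (Tr k j fun m => V k m g))
    (hTdep : ∀ k j (a a' : ℕ → F), (∀ m ≤ j, a m = a' m) → Tr k j a = Tr k j a')
    (hT : ∀ k j (D : Set ℂ) (W : ℕ → ℂ → F), (∀ m ≤ j, DifferentiableOn ℂ (W m) D) →
      DifferentiableOn ℂ (fun z => Tr k j fun m => W m z) D)
    (hold : ∀ k j, ∀ s ∈ Set.Ici t₀, ∃ U : Set F, DifferentiableOn ℂ (Φ k j (s : ℂ)) U ∧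
      ∀ a : ℕ → F, (∀ m ≤ j, a m ∈ A k m) → Tr k j a ∈ U ∧ Φ k j (s : ℂ) (Tr k j a) ∈ A k (j + 1))
    (hlast : ∀ k j, ∀ h ∈ BoxWindow (Set.Ici t₀), ∃ D : Set ℂ,
      DifferentiableOn ℂ (fun z => Φ k j z (Tr k j fun m => V k m h)) D ∧
        (∀ z ∈ D, Φ k j z (Tr k j fun m => V k m h) ∈ A k (j + 1)) ∧ ∀ s ∈ Set.Ici t₀, closedBall (s : ℂ) (c * |s|) ⊆ D)
    (hev : ∀ k (b b' : F) (U : T.B) (X : T.Dom),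
      |ev k b U X - ev k b' U X| ≤ Real.exp (-(κ * T.d X)) * ‖b - b'‖)
    (hE : ∀ k, ∀ g ∈ BoxWindow (Set.Ici t₀), ∀ (U : T.B) (X : T.Dom), E k g U X = ev k (V k (k - T.r X) g) U X) :
    TowerNE9On T E (Set.Ici t₀) κ fun _ _ => 4 * Bbar / (c * t₀) := fun k =>
  ne9_boxWindow_of_propagation (C := T.level k) (E := E k) (B := fun _ => Bbar) (ev k) Set.ordConnected_Ici ht₀ hc
    (fun _ hs => hs) (hAB k) (fun _ => le_rfl) (hP k) (hmem k) (hrec k) (hTdep k) (hT k) (hold k) (hlast k) (hev k) (hE k)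

/-- **THE ANALYTIC BRANCH OF NE9-AS-CONSUMED, END TO END (rows C29 + C29b).**  Tower-NE5 over the t-box `[t₀,∞[` + per-run propagation data
((P)(M)(R)(O)(L)(E) above, ONE class bound `B̄ ≥ 0`) + a nonnegative t-discrepancy profile of finite first moment (node U2: the record's `C·θ′^i` or
(E33g)'s `L·ρ^⌊√i⌋`, `MemoryFromRate.firstMoment_profiles`) ⇒ the cutoff-independent injection
`inj K j := 2C₅θ^{j∕2}∕(1−θ) + (4B̄∕(c t₀))·Σ_{i∈[j∕2,j)} d_i` dominates node U3's coupling bracket of every pair of admissible t-histories with that profile at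
every domain of every run, AND `Summable (T4CauchySum.delta E₀ ρ inj)` — `TowerCarriersBox.summable_delta_of_towerOn_bounded` on
`towerNE9On_of_propagation`.  USED: tower-NE5, holomorphy and class reproduction (qualitative), Cauchy on a margin, the young∕old split.  NOT USED:
any constant of the one-step map, (CONTR), the memory-rate gap, W4, W5, `FadingMemory`, N2. [folklore] -/
theorem summable_delta_of_propagation (T : TowerData) {E : ℕ → (ℕ → ℝ) → T.B → T.Dom → ℝ}
    {V : ℕ → ℕ → (ℕ → ℝ) → F} {Φ : ℕ → ℕ → ℂ → F → F} {Tr : ℕ → ℕ → (ℕ → F) → F} {A : ℕ → ℕ → Set F}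
    {ev : (k : ℕ) → F → T.B → T.Dom → ℝ} {t₀ c Bbar κ θ C₅ : ℝ} {d : ℕ → ℝ}
    (ht₀ : 0 < t₀) (hc : 0 < c) (hBbar : 0 ≤ Bbar) (hC : 0 ≤ C₅) (hθ0 : 0 ≤ θ) (hθ1 : θ < 1) (hκ : 0 ≤ κ)
    (h5 : TowerNE5On T E (Set.Ici t₀) κ θ C₅)
    (hAB : ∀ k m, ∀ a ∈ A k m, ‖a‖ ≤ Bbar)
    (hP : ∀ k m, ∀ g ∈ BoxWindow (Set.Ici t₀), ∀ g' ∈ BoxWindow (Set.Ici t₀), (∀ n < m, g n = g' n) → V k m g = V k m g')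
    (hmem : ∀ k m, ∀ g ∈ BoxWindow (Set.Ici t₀), V k m g ∈ A k m)
    (hrec : ∀ k j, ∀ g ∈ BoxWindow (Set.Ici t₀), V k (j + 1) g = Φ k j (g j : ℂ) (Tr k j fun m => V k m g))
    (hTdep : ∀ k j (a a' : ℕ → F), (∀ m ≤ j, a m = a' m) → Tr k j a = Tr k j a')
    (hT : ∀ k j (D : Set ℂ) (W : ℕ → ℂ → F), (∀ m ≤ j, DifferentiableOn ℂ (W m) D) →
      DifferentiableOn ℂ (fun z => Tr k j fun m => W m z) D)
    (hold : ∀ k j, ∀ s ∈ Set.Ici t₀, ∃ U : Set F, DifferentiableOn ℂ (Φ k j (s : ℂ)) U ∧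
      ∀ a : ℕ → F, (∀ m ≤ j, a m ∈ A k m) → Tr k j a ∈ U ∧ Φ k j (s : ℂ) (Tr k j a) ∈ A k (j + 1))
    (hlast : ∀ k j, ∀ h ∈ BoxWindow (Set.Ici t₀), ∃ D : Set ℂ,
      DifferentiableOn ℂ (fun z => Φ k j z (Tr k j fun m => V k m h)) D ∧
        (∀ z ∈ D, Φ k j z (Tr k j fun m => V k m h) ∈ A k (j + 1)) ∧ ∀ s ∈ Set.Ici t₀, closedBall (s : ℂ) (c * |s|) ⊆ D)
    (hev : ∀ k (b b' : F) (U : T.B) (X : T.Dom),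
      |ev k b U X - ev k b' U X| ≤ Real.exp (-(κ * T.d X)) * ‖b - b'‖)
    (hE : ∀ k, ∀ g ∈ BoxWindow (Set.Ici t₀), ∀ (U : T.B) (X : T.Dom), E k g U X = ev k (V k (k - T.r X) g) U X)
    (hd0 : ∀ i, 0 ≤ d i) (hd1 : Summable (fun i : ℕ => ((i : ℝ) + 1) * d i))
    {E₀ ρ : ℝ} (hE₀ : 0 ≤ E₀) (hρ : 0 ≤ ρ) (hρ1 : ρ < 1) :
    let inj : ℕ → ℕ → ℝ := fun _ j => 2 * C₅ * θ ^ (j / 2) / (1 - θ) + 4 * Bbar / (c * t₀) * ∑ i ∈ Ico (j / 2) j, d i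
    (∀ (K k : ℕ) (U : T.B) (X : T.Dom), T.r X ≤ k → ∀ t ∈ BoxWindow (Set.Ici t₀), ∀ t' ∈ BoxWindow (Set.Ici t₀),
        (∀ i, |t i - t' i| ≤ d i) → |E k t U X - E k t' U X| ≤ inj K (k - T.r X)) ∧
      Summable (delta E₀ ρ inj) :=
  summable_delta_of_towerOn_bounded T hC hθ0 hθ1 (by positivity) hκ h5
    (towerNE9On_of_propagation T ht₀ hc hAB hP hmem hrec hTdep hT hold hlast hev hE)
    (fun _ _ _ => ⟨by positivity, le_rfl⟩) hd0 hd1 hE₀ hρ hρ1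

end Composite

/-! ## §2 Non-vacuity: the vertex toy IS an instance of the propagation data, and the composite END fires on it -/

section VertexToy

open Literature.MathematicalPhysics.QuantumFieldTheory.Balaban1983to89.T4CouplingAnalyticity (norm_cos_le_exp_pi)

variable {a : ℝ}

/-- The class radius of the vertex toy: `R = e^π∕(1−a)` — `a·R + e^π = R`, and `1∕(1−a) ≤ R`. [folklore] -/
theorem classRadius_eq (ha1 : a < 1) : a * (Real.exp Real.pi / (1 - a)) + Real.exp Real.pi = Real.exp Real.pi / (1 - a) := by
  have h : (1 - a) ≠ 0 := by linarith
  field_simp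
  ring

/-- **THE VERTEX TOY INSTANTIATES EVERY BINDER OF `summable_delta_of_propagation` AND THE END FIRES** (`0 < t₀`, `0 < c < 1`, `0 ≤ a < 1`,
`0 ≤ κ`, node U2's record profile `Cθ·θ′^i`): activities `V k j t = linTower a vertexOsc j t ∈ ℂ` (`F = ℂ`), steps `Φ z w = a·w + cos(log z)`,
transport `Tr j b = b j` (the last activity — reads the levels `≤ j`, preserves holomorphy), classes `A k m =` the closed disc of radius
`e^π∕(1−a)` (reproduced: `a·R + e^π = R`; real couplings give `a·R + 1 ≤ R`), [H-dil]-STEP on `Re z > 0` by the owner's `norm_cos_le_exp_pi`,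
evaluation `ev b = Re b` (1-Lipschitz); tower-NE5 over the t-box by `towerNE5On_vertexToy`.  Conclusion: the composite END's injection
dominates every t-currency bracket of the toy and `Summable (T4CauchySum.delta E₀ ρ inj)` — every hypothesis of rows C29 + C29b discharged at
once, none vacuously (`TowerCarriersBoxWitness.vertexToy_nonconstant`). [folklore] -/
theorem summable_delta_propagation_vertexToy {t₀ c κ Cθ θ' : ℝ} (ht₀ : 0 < t₀) (hc0 : 0 < c) (hc1 : c < 1)
    (ha0 : 0 ≤ a) (ha1 : a < 1) (hκ : 0 ≤ κ) (hCθ : 0 ≤ Cθ) (hθ'0 : 0 ≤ θ') (hθ'1 : θ' < 1)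
    {E₀ ρ : ℝ} (hE₀ : 0 ≤ E₀) (hρ : 0 ≤ ρ) (hρ1 : ρ < 1) :
    let inj : ℕ → ℕ → ℝ := fun _ j =>
      2 * 1 * a ^ (j / 2) / (1 - a) + 4 * (Real.exp Real.pi / (1 - a)) / (c * t₀) * ∑ i ∈ Ico (j / 2) j, Cθ * θ' ^ i
    (∀ (K k : ℕ) (U : toyTower.B) (X : toyTower.Dom), toyTower.r X ≤ k →
        ∀ t ∈ BoxWindow (Set.Ici t₀), ∀ t' ∈ BoxWindow (Set.Ici t₀), (∀ i, |t i - t' i| ≤ Cθ * θ' ^ i) →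
          |toyE a vertexOsc k t U X - toyE a vertexOsc k t' U X| ≤ inj K (k - toyTower.r X)) ∧
      Summable (delta E₀ ρ inj) := by
  have h1a : 0 < 1 - a := by linarith
  set R : ℝ := Real.exp Real.pi / (1 - a) with hR
  have hR0 : 0 ≤ R := by positivity
  have hπ1 : (1 : ℝ) ≤ Real.exp Real.pi := Real.one_le_exp Real.pi_pos.le
  have hRinv : 1 / (1 - a) ≤ R := div_le_div_of_nonneg_right hπ1 h1a.le
  have haR : a * R + Real.exp Real.pi = R := classRadius_eq ha1
  -- the class bound for the toy activities
  have hlin : ∀ (j : ℕ) (t : ℕ → ℝ), ‖((linTower a vertexOsc j t : ℝ) : ℂ)‖ ≤ R := fun j t => by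
    rw [Complex.norm_real, Real.norm_eq_abs]
    exact (abs_linTower_le ha0 ha1 abs_vertexOsc_le j t).trans hRinv
  -- the step at a point of the class: `‖a·w + u‖ ≤ a·R + ‖u‖`
  have hstep : ∀ (w u : ℂ), ‖w‖ ≤ R → ‖(a : ℂ) * w + u‖ ≤ a * R + ‖u‖ := fun w u hw => by
    calc ‖(a : ℂ) * w + u‖ ≤ ‖(a : ℂ) * w‖ + ‖u‖ := norm_add_le _ _
      _ ≤ a * R + ‖u‖ := by
          rw [norm_mul, Complex.norm_real, Real.norm_eq_abs, abs_of_nonneg ha0]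
          exact add_le_add (mul_le_mul_of_nonneg_left hw ha0) le_rfl
  refine summable_delta_of_propagation toyTower
    (E := toyE a vertexOsc)
    (V := fun _ j t => ((linTower a vertexOsc j t : ℝ) : ℂ))
    (Φ := fun _ _ z w => (a : ℂ) * w + Complex.cos (Complex.log z))
    (Tr := fun _ j b => b j)
    (A := fun _ _ => {w : ℂ | ‖w‖ ≤ R})
    (ev := fun _ b _ _ => b.re)
    ht₀ hc0 hR0 zero_le_one ha0 ha1 hκ (towerNE5On_vertexToy ha0) ?_ ?_ ?_ ?_ ?_ ?_ ?_ ?_ ?_ ?_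
    (fun i => by positivity) (MemoryFromRate.firstMoment_profiles (L := 0) hθ'0 hθ'1 le_rfl zero_lt_one).1 hE₀ hρ hρ1
  · -- (hAB) the classes are bounded by `R`
    intro _ _ w hw; exact hw
  · -- (P) prefix dependence
    intro _ m g _ g' _ hagree
    show ((linTower a vertexOsc m g : ℝ) : ℂ) = ((linTower a vertexOsc m g' : ℝ) : ℂ)
    rw [linTower_congr m hagree]
  · -- (M) class membership of the real-history activities
    intro _ m g _; exact hlin m g
  · -- (R) the recursion `linTower (j+1) t = a·linTower j t + cos(log t_j)` read in ℂ
    intro _ j g hg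
    have hgj : 0 < g j := lt_of_lt_of_le ht₀ (hg j)
    show ((linTower a vertexOsc (j + 1) g : ℝ) : ℂ) =
      (a : ℂ) * ((linTower a vertexOsc j g : ℝ) : ℂ) + Complex.cos (Complex.log ((g j : ℝ) : ℂ))
    rw [linTower_succ, ← Complex.ofReal_log hgj.le, ← Complex.ofReal_cos]
    unfold vertexOsc
    push_cast
    ring
  · -- transport reads the levels ≤ j
    intro _ j b b' hb; exact hb j le_rfl
  · -- transport preserves holomorphy
    intro _ j D W hW; exact hW j le_rfl
  · -- (O) holomorphic in the old data, class reproduced at REAL last couplings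
    intro _ j s hs
    have hs0 : 0 < s := lt_of_lt_of_le ht₀ hs
    refine ⟨Set.univ, ?_, fun b hb => ⟨Set.mem_univ _, ?_⟩⟩
    · exact ((differentiable_id.const_mul _).add_const _).differentiableOn
    · show ‖(a : ℂ) * b j + Complex.cos (Complex.log ((s : ℝ) : ℂ))‖ ≤ R
      have hcos : ‖Complex.cos (Complex.log ((s : ℝ) : ℂ))‖ ≤ Real.exp Real.pi := by
        rw [← Complex.ofReal_log hs0.le, ← Complex.ofReal_cos, Complex.norm_real, Real.norm_eq_abs]
        exact (Real.abs_cos_le_one _).trans hπ1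
      calc ‖(a : ℂ) * b j + Complex.cos (Complex.log ((s : ℝ) : ℂ))‖
          ≤ a * R + ‖Complex.cos (Complex.log ((s : ℝ) : ℂ))‖ := hstep _ _ (hb j le_rfl)
        _ ≤ a * R + Real.exp Real.pi := add_le_add le_rfl hcos
        _ = R := haR
  · -- (L) [H-dil]-STEP: holomorphic in a complex last coupling on `Re z > 0 ⊇` the relative discs, values in the class
    intro _ j h _
    refine ⟨{z | 0 < z.re}, ?_, ?_, ?_⟩
    · intro z hz
      exact (((Complex.differentiableAt_log (Or.inl hz)).ccos).const_add _).differentiableWithinAt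
    · intro z _
      show ‖(a : ℂ) * ((linTower a vertexOsc j h : ℝ) : ℂ) + Complex.cos (Complex.log z)‖ ≤ R
      calc ‖(a : ℂ) * ((linTower a vertexOsc j h : ℝ) : ℂ) + Complex.cos (Complex.log z)‖
          ≤ a * R + ‖Complex.cos (Complex.log z)‖ := hstep _ _ (hlin j h)
        _ ≤ a * R + Real.exp Real.pi :=
            add_le_add le_rfl (norm_cos_le_exp_pi (by rw [Complex.log_im]; exact Complex.abs_arg_le_pi _))
        _ = R := haR
    · intro s hs z hz
      have hs0 : 0 < s := lt_of_lt_of_le ht₀ hs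
      rw [Metric.mem_closedBall, dist_eq_norm, abs_of_pos hs0] at hz
      show 0 < z.re
      have hre : ((s : ℂ) - z).re ≤ c * s := (Complex.re_le_norm _).trans (by rwa [norm_sub_rev])
      have hre' : ((s : ℂ) - z).re = s - z.re := by simp
      nlinarith
  · -- (E) the evaluation `Re` is 1-Lipschitz (tree length 0)
    intro _ b b' U X
    show |b.re - b'.re| ≤ Real.exp (-(κ * 0)) * ‖b - b'‖
    rw [mul_zero, neg_zero, Real.exp_zero, one_mul, ← Complex.sub_re]
    exact Complex.abs_re_le_norm _
  · -- the toy functional IS the evaluated activity at scale `k − r X = k`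
    intro k g _ U X
    show linTower a vertexOsc k g = (((linTower a vertexOsc (k - 0) g : ℝ) : ℂ)).re
    rw [Nat.sub_zero, Complex.ofReal_re]

end VertexToy

end Summit.QuantumFields.BalabanUV.T4Continuum.NE9.AnalyticBranchAssembly
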